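import Summits.Parity.BatemanHorn.Theses.SelmerPencil
import Literature.NumberTheory.EllipticCurves.RootNumber

/-!
# StrategyCensus — crux `PencilSelmerParity` (stmt-Parity-11296), route `SelmerPencil`

Typed companion of `STRATEGY-CENSUS.md` (crux-strategist r1, redirect scan 2026-08-17).

What is certified here (sorry-free):

* `eps_mul_self`      — the additive sign `ε(N)` of the closed form is `±1` (`ε·ε = 1`):
                         `p ∣ 1728N+1 ⇒ p ≠ 3`, so every `jacobiSym (-3) p` factor squares to `1`.
* `omega_mul_eps'`    — `(-1)^{ω(N)} · ε′(N) = λ(N)` for `N ≠ 0`, `ε′(N) = ∏_{p ∣ N} (-1)^{v_p(N)+1}`.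
* `summand_eq`        — under the crux `PencilSelmerParity` (a theorem in print: Dokchitser–Dokchitser
                         2010 Thm 1.4 ∘ Deligne–Rohrlich ∘ Rohrlich 1993), the summand of the route's
                         Selmer crux r3 is MINUS the Liouville summand of r5, value by value:
                         `ε(N)·ε′(N)·(-1)^{corank Sel_2∞(E_N)} = -λ(N)` for every `N ≥ 1`.
* `selmerParityLevel_iff_liouvilleRootClassLevel` —
                         `PencilSelmerParity → (SelmerParityLevel ↔ LiouvilleRootClassLevel)`:
                         modulo the printed theorem, the route's load-bearing Selmer crux r3
                         (stmt-Parity-9646) IS the λ-level crux r5 (stmt-Parity-9648, censused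
                         `no-decomposition` by cstrat-stmt-Parity-9648-r1) — the COSTUME THEOREM.

Nothing here is a proof of the crux itself (that is the 2-parity theorem for the pencil
`E_N : y² + xy = x³ − 36N·x − N`, `j = 1728 + 1/N`, unprovable in Lean until the tree's named facts
`WeierstrassCurve.p_parity` / `rootNumber_eq_algebraicRootNumber` carry `_holds`).
-/

namespace Summit.Parity.BatemanHorn.Cruxes.PencilSelmerParity.StrategyCensus

open scoped BigOperators Topology Manifold Classical MeasureTheory ProbabilityTheory Matrix InnerProductSpace ComplexConjugate ContinuousMap
open Filter Set Function TopologicalSpace MeasureTheory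
open Summit.Parity.BatemanHorn.Theses.SelmerPencil

/-- `ω(n) = #primeFactors(n)` (folklore). -/
theorem cardDistinctFactors_eq_card_primeFactors (n : ℕ) :
    ArithmeticFunction.cardDistinctFactors n = n.primeFactors.card := by
  rw [ArithmeticFunction.cardDistinctFactors_apply, ← List.card_toFinset]; rfl

/-- A prime divisor of `1728N+1` is not `3` (since `1728 = 3·576`). -/
theorem ne_three_of_mem_primeFactors {N p : ℕ} (hp : p ∈ (1728 * N + 1).primeFactors) : p ≠ 3 := by
  rintro rfl
  have h := Nat.dvd_of_mem_primeFactors hp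
  omega

/-- Each factor of `ε(N)` squares to `1`. -/
theorem factor_mul_self {N p : ℕ} (hp : p ∈ (1728 * N + 1).primeFactors) :
    (if padicValNat p (1728 * N + 1) % 6 = 2 ∨ padicValNat p (1728 * N + 1) % 6 = 4
        then jacobiSym (-3) p else 1) *
      (if padicValNat p (1728 * N + 1) % 6 = 2 ∨ padicValNat p (1728 * N + 1) % 6 = 4
        then jacobiSym (-3) p else 1) = 1 := by
  have hprime : p.Prime := Nat.prime_of_mem_primeFactors hp
  have hne : p ≠ 3 := ne_three_of_mem_primeFactors hp
  split_ifs with h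
  · have hgcd : (-3 : ℤ).gcd (p : ℤ) = 1 := by
      rw [Int.gcd_eq_natAbs]
      have hcop : Nat.Coprime 3 p := (Nat.coprime_primes Nat.prime_three hprime).mpr (Ne.symm hne)
      simpa using hcop
    have hsq := jacobiSym.sq_one (a := -3) (b := p) hgcd
    rw [sq] at hsq
    exact hsq
  · norm_num

/-- `ε(N)·ε(N) = 1`: the additive-part sign of the closed form is `±1`. -/
theorem eps_mul_self (N : ℕ) :
    (∏ p ∈ (1728 * N + 1).primeFactors,
        (if padicValNat p (1728 * N + 1) % 6 = 2 ∨ padicValNat p (1728 * N + 1) % 6 = 4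
          then jacobiSym (-3) p else 1)) *
      (∏ p ∈ (1728 * N + 1).primeFactors,
        (if padicValNat p (1728 * N + 1) % 6 = 2 ∨ padicValNat p (1728 * N + 1) % 6 = 4
          then jacobiSym (-3) p else 1)) = 1 := by
  rw [← Finset.prod_mul_distrib]
  exact Finset.prod_eq_one fun p hp => factor_mul_self hp

/-- `Σ_{p ∣ N} v_p(N) = Ω(N)`. -/
theorem sum_padicValNat_eq_cardFactors (N : ℕ) :
    ∑ p ∈ N.primeFactors, padicValNat p N = ArithmeticFunction.cardFactors N := by
  rw [ArithmeticFunction.cardFactors_eq_sum_factorization, Finsupp.sum, Nat.support_factorization]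
  exact Finset.sum_congr rfl fun p hp =>
    (Nat.factorization_def N (Nat.prime_of_mem_primeFactors hp)).symm

/-- `(-1)^{ω(N)} · ε′(N) = λ(N)` for `N ≠ 0`, where `ε′(N) = ∏_{p ∣ N} (-1)^{v_p(N)+1}`. -/
theorem omega_mul_eps' {N : ℕ} (hN : N ≠ 0) :
    (-1 : ℤ) ^ ArithmeticFunction.cardDistinctFactors N *
        ∏ p ∈ N.primeFactors, (-1 : ℤ) ^ (padicValNat p N + 1) =
      ArithmeticFunction.liouville N := by
  rw [ArithmeticFunction.liouville_apply hN, cardDistinctFactors_eq_card_primeFactors,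
    ← sum_padicValNat_eq_cardFactors]
  simp_rw [pow_succ]
  rw [Finset.prod_mul_distrib, Finset.prod_const, Finset.prod_pow_eq_pow_sum]
  have hc : (-1 : ℤ) ^ N.primeFactors.card * (-1 : ℤ) ^ N.primeFactors.card = 1 := by
    rw [← pow_add]; exact Even.neg_one_pow ⟨_, rfl⟩
  calc (-1 : ℤ) ^ N.primeFactors.card *
        ((-1 : ℤ) ^ (∑ p ∈ N.primeFactors, padicValNat p N) * (-1 : ℤ) ^ N.primeFactors.card)
        = ((-1 : ℤ) ^ N.primeFactors.card * (-1 : ℤ) ^ N.primeFactors.card) *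
            (-1 : ℤ) ^ (∑ p ∈ N.primeFactors, padicValNat p N) := by ring
    _ = (-1 : ℤ) ^ (∑ p ∈ N.primeFactors, padicValNat p N) := by rw [hc, one_mul]

/-- **Summand identity (the dictionary, value by value).** Under the crux `PencilSelmerParity`,
for every `N ≥ 1`: `ε(N)·ε′(N)·(-1)^{corank_{ℤ₂} Sel_{2^∞}(E_N/ℚ)} = −λ(N)`. -/
theorem summand_eq (hP : PencilSelmerParity) {N : ℕ} (hN : 1 ≤ N) :
    (∏ p ∈ (1728 * N + 1).primeFactors,
        (if padicValNat p (1728 * N + 1) % 6 = 2 ∨ padicValNat p (1728 * N + 1) % 6 = 4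
          then jacobiSym (-3) p else 1)) *
      (∏ p ∈ N.primeFactors, (-1 : ℤ) ^ (padicValNat p N + 1)) *
      (-1 : ℤ) ^ (WeierstrassCurve.selmerCorank
        (⟨1, 0, 0, -36 * ((N : ℕ) : ℚ), -((N : ℕ) : ℚ)⟩ : WeierstrassCurve ℚ) 2) =
      -(ArithmeticFunction.liouville N : ℤ) := by
  have h0 := hP N hN
  have h1 := eps_mul_self N
  have h2 := omega_mul_eps' (N := N) (by omega)
  rw [h0]
  linear_combination
    (-((-1 : ℤ) ^ ArithmeticFunction.cardDistinctFactors N *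
        ∏ p ∈ N.primeFactors, (-1 : ℤ) ^ (padicValNat p N + 1))) * h1 - h2

/-- Inner-sum identity along one root class: the Selmer inner sum of r3 is minus the Liouville
inner sum of r5 (any polynomial `F`, any modulus `m`, class `ρ`, cut-off `Y`). -/
theorem inner_eq (hP : PencilSelmerParity) (F : Polynomial ℤ) (m ρ Y : ℕ) :
    ∑ t ∈ (Finset.Icc 1 Y).filter (fun t : ℕ => t ≡ ρ [MOD m] ∧ 0 < F.eval (t : ℤ)),
      (((∏ p ∈ (1728 * (F.eval (t : ℤ)).toNat + 1).primeFactors,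
          (if padicValNat p (1728 * (F.eval (t : ℤ)).toNat + 1) % 6 = 2 ∨
              padicValNat p (1728 * (F.eval (t : ℤ)).toNat + 1) % 6 = 4
            then jacobiSym (-3) p else 1)) *
        (∏ p ∈ ((F.eval (t : ℤ)).toNat).primeFactors,
          (-1 : ℤ) ^ (padicValNat p ((F.eval (t : ℤ)).toNat) + 1)) *
        (-1 : ℤ) ^ (WeierstrassCurve.selmerCorank
          (⟨1, 0, 0, -36 * ((((F.eval (t : ℤ)).toNat : ℕ)) : ℚ),
            -((((F.eval (t : ℤ)).toNat : ℕ)) : ℚ)⟩ : WeierstrassCurve ℚ) 2) : ℤ) : ℝ) =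
      -∑ t ∈ (Finset.Icc 1 Y).filter (fun t : ℕ => t ≡ ρ [MOD m] ∧ 0 < F.eval (t : ℤ)),
        (ArithmeticFunction.liouville ((F.eval (t : ℤ)).toNat) : ℝ) := by
  rw [← Finset.sum_neg_distrib]
  refine Finset.sum_congr rfl fun t ht => ?_
  rw [Finset.mem_filter] at ht
  have hpos : 0 < F.eval (t : ℤ) := ht.2.2
  have hN : 1 ≤ (F.eval (t : ℤ)).toNat := by
    have h1 : (0 : ℕ) < (F.eval (t : ℤ)).toNat := Int.lt_toNat.mpr (by simpa using hpos)
    omega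
  have key := summand_eq hP hN
  have key' : (((∏ p ∈ (1728 * (F.eval (t : ℤ)).toNat + 1).primeFactors,
          (if padicValNat p (1728 * (F.eval (t : ℤ)).toNat + 1) % 6 = 2 ∨
              padicValNat p (1728 * (F.eval (t : ℤ)).toNat + 1) % 6 = 4
            then jacobiSym (-3) p else 1)) *
        (∏ p ∈ ((F.eval (t : ℤ)).toNat).primeFactors,
          (-1 : ℤ) ^ (padicValNat p ((F.eval (t : ℤ)).toNat) + 1)) *
        (-1 : ℤ) ^ (WeierstrassCurve.selmerCorank
          (⟨1, 0, 0, -36 * ((((F.eval (t : ℤ)).toNat : ℕ)) : ℚ),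
            -((((F.eval (t : ℤ)).toNat : ℕ)) : ℚ)⟩ : WeierstrassCurve ℚ) 2) : ℤ) : ℝ) =
      ((-(ArithmeticFunction.liouville ((F.eval (t : ℤ)).toNat) : ℤ) : ℤ) : ℝ) := by
    exact_mod_cast congrArg (fun z : ℤ => (z : ℝ)) key
  rw [key']
  push_cast
  ring

/-- The double sums of r3 and r5 agree (the `|·|` kills the global sign). -/
theorem lhs_eq (hP : PencilSelmerParity) (k : ℕ) (f : Fin k → Polynomial ℤ) (B : ℕ)
    (y : ℕ → ℕ → ℕ) :
    ∑ m ∈ Finset.Icc 1 B, ∑ ρ ∈ (Finset.range m).filter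
        (fun ρ : ℕ => (m : ℤ) ∣ (∏ i, f i).eval (ρ : ℤ)),
      |∑ t ∈ (Finset.Icc 1 (y m ρ)).filter
          (fun t : ℕ => t ≡ ρ [MOD m] ∧ 0 < (∏ i, f i).eval (t : ℤ)),
        (((∏ p ∈ (1728 * ((∏ i, f i).eval (t : ℤ)).toNat + 1).primeFactors,
            (if padicValNat p (1728 * ((∏ i, f i).eval (t : ℤ)).toNat + 1) % 6 = 2 ∨
                padicValNat p (1728 * ((∏ i, f i).eval (t : ℤ)).toNat + 1) % 6 = 4
              then jacobiSym (-3) p else 1)) *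
          (∏ p ∈ (((∏ i, f i).eval (t : ℤ)).toNat).primeFactors,
            (-1 : ℤ) ^ (padicValNat p (((∏ i, f i).eval (t : ℤ)).toNat) + 1)) *
          (-1 : ℤ) ^ (WeierstrassCurve.selmerCorank
            (⟨1, 0, 0, -36 * ((((∏ i, f i).eval (t : ℤ)).toNat : ℕ) : ℚ),
              -((((∏ i, f i).eval (t : ℤ)).toNat : ℕ) : ℚ)⟩ : WeierstrassCurve ℚ) 2) : ℤ) : ℝ)| =
    ∑ m ∈ Finset.Icc 1 B, ∑ ρ ∈ (Finset.range m).filter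
        (fun ρ : ℕ => (m : ℤ) ∣ (∏ i, f i).eval (ρ : ℤ)),
      |∑ t ∈ (Finset.Icc 1 (y m ρ)).filter
          (fun t : ℕ => t ≡ ρ [MOD m] ∧ 0 < (∏ i, f i).eval (t : ℤ)),
        (ArithmeticFunction.liouville (((∏ i, f i).eval (t : ℤ)).toNat) : ℝ)| := by
  refine Finset.sum_congr rfl fun m _ => Finset.sum_congr rfl fun ρ _ => ?_
  rw [inner_eq hP (∏ i, f i) m ρ (y m ρ), abs_neg]

/-- **COSTUME THEOREM.** Modulo the printed theorem `PencilSelmerParity` (2-parity ∘ product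
formula ∘ Rohrlich's table on the pencil), the route's load-bearing Selmer crux r3
`SelmerParityLevel` (stmt-Parity-9646) is EQUIVALENT to its λ-side crux r5
`LiouvilleRootClassLevel` (stmt-Parity-9648). Forward direction = the route's support
`ParityToLiouville` (stmt-Parity-11298); the converse is the same identity read backwards. -/
theorem selmerParityLevel_iff_liouvilleRootClassLevel (hP : PencilSelmerParity) :
    SelmerParityLevel ↔ LiouvilleRootClassLevel := by
  unfold SelmerParityLevel LiouvilleRootClassLevel
  constructor
  · intro h k f hk hBH η hη hη' A hA
    obtain ⟨x₀, hx₀⟩ := h k f hk hBH η hη hη' A hA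
    refine ⟨x₀, fun x hx y hy => ?_⟩
    have hxy := hx₀ x hx y hy
    rwa [lhs_eq hP k f ⌊(x : ℝ) ^ (1 - η)⌋₊ y] at hxy
  · intro h k f hk hBH η hη hη' A hA
    obtain ⟨x₀, hx₀⟩ := h k f hk hBH η hη hη' A hA
    refine ⟨x₀, fun x hx y hy => ?_⟩
    have hxy := hx₀ x hx y hy
    rwa [← lhs_eq hP k f ⌊(x : ℝ) ^ (1 - η)⌋₊ y] at hxy

/-- The route's support item `ParityToLiouville` (stmt-Parity-11298), as a corollary. -/
theorem parityToLiouville : ParityToLiouville :=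
  fun hP hS => (selmerParityLevel_iff_liouvilleRootClassLevel hP).mp hS

/-- And its converse: the λ-level crux r5 gives back the Selmer crux r3 under the dictionary. -/
theorem liouvilleToParity (hP : PencilSelmerParity) (hL : LiouvilleRootClassLevel) :
    SelmerParityLevel :=
  (selmerParityLevel_iff_liouvilleRootClassLevel hP).mpr hL

end Summit.Parity.BatemanHorn.Cruxes.PencilSelmerParity.StrategyCensus

/-! ## The decorative Selmer crux r4 is the Möbius atom in progressions, in costume -/

namespace Summit.Parity.BatemanHorn.Cruxes.PencilSelmerParity.StrategyCensus

open scoped BigOperators Topology Classical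
open Filter Asymptotics
open Summit.Parity.BatemanHorn.Theses.SelmerPencil

/-- On a square-free `N ≥ 1`, under the crux: `ε(N)·(-1)^{corank Sel_2∞(E_N)} = −μ(N)`. -/
theorem atom_summand_eq (hP : PencilSelmerParity) {N : ℕ} (hN : 1 ≤ N) (hsq : Squarefree N) :
    (∏ p ∈ (1728 * N + 1).primeFactors,
        (if padicValNat p (1728 * N + 1) % 6 = 2 ∨ padicValNat p (1728 * N + 1) % 6 = 4
          then jacobiSym (-3) p else 1)) *
      (-1 : ℤ) ^ (WeierstrassCurve.selmerCorank
        (⟨1, 0, 0, -36 * ((N : ℕ) : ℚ), -((N : ℕ) : ℚ)⟩ : WeierstrassCurve ℚ) 2) =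
      -(ArithmeticFunction.moebius N : ℤ) := by
  have h0 := hP N hN
  have h1 := eps_mul_self N
  have hN0 : N ≠ 0 := by omega
  have hμ : (ArithmeticFunction.moebius N : ℤ) = (-1 : ℤ) ^ ArithmeticFunction.cardDistinctFactors N := by
    rw [ArithmeticFunction.moebius_apply_of_squarefree hsq,
      (ArithmeticFunction.cardDistinctFactors_eq_cardFactors_iff_squarefree hN0).mpr hsq]
  rw [h0, hμ]
  linear_combination (-((-1 : ℤ) ^ ArithmeticFunction.cardDistinctFactors N)) * h1

/-- r4's `x`-indexed sum is minus the Möbius sum, for every `f, q, a, x`. -/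
theorem atom_sum_eq (hP : PencilSelmerParity) (f : Polynomial ℤ) (q a x : ℕ) :
    ∑ t ∈ (Finset.Icc 1 x).filter (fun t : ℕ => t ≡ a [MOD q] ∧ 0 < f.eval (t : ℤ) ∧
        Squarefree (f.eval (t : ℤ)).toNat),
      (((∏ p ∈ (1728 * (f.eval (t : ℤ)).toNat + 1).primeFactors,
          (if padicValNat p (1728 * (f.eval (t : ℤ)).toNat + 1) % 6 = 2 ∨
              padicValNat p (1728 * (f.eval (t : ℤ)).toNat + 1) % 6 = 4
            then jacobiSym (-3) p else 1)) *
        (-1 : ℤ) ^ (WeierstrassCurve.selmerCorank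
          (⟨1, 0, 0, -36 * (((f.eval (t : ℤ)).toNat : ℕ) : ℚ),
            -(((f.eval (t : ℤ)).toNat : ℕ) : ℚ)⟩ : WeierstrassCurve ℚ) 2) : ℤ) : ℝ) =
      -∑ t ∈ (Finset.Icc 1 x).filter (fun t : ℕ => t ≡ a [MOD q] ∧ 0 < f.eval (t : ℤ) ∧
          Squarefree (f.eval (t : ℤ)).toNat),
        (ArithmeticFunction.moebius ((f.eval (t : ℤ)).toNat) : ℝ) := by
  rw [← Finset.sum_neg_distrib]
  refine Finset.sum_congr rfl fun t ht => ?_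
  rw [Finset.mem_filter] at ht
  have hpos : 0 < f.eval (t : ℤ) := ht.2.2.1
  have hsq : Squarefree (f.eval (t : ℤ)).toNat := ht.2.2.2
  have hN : 1 ≤ (f.eval (t : ℤ)).toNat := by
    have h1 : (0 : ℕ) < (f.eval (t : ℤ)).toNat := Int.lt_toNat.mpr (by simpa using hpos)
    omega
  have key := atom_summand_eq hP hN hsq
  have key' := congrArg (fun z : ℤ => (z : ℝ)) key
  simp only [Int.cast_neg] at key'
  exact_mod_cast key'

/-- Dropping the `Squarefree` conjunct changes nothing (`μ = 0` off square-free values). -/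
theorem mobius_sum_squarefree_filter (f : Polynomial ℤ) (q a x : ℕ) :
    ∑ t ∈ (Finset.Icc 1 x).filter (fun t : ℕ => t ≡ a [MOD q] ∧ 0 < f.eval (t : ℤ) ∧
        Squarefree (f.eval (t : ℤ)).toNat),
      (ArithmeticFunction.moebius ((f.eval (t : ℤ)).toNat) : ℝ) =
    ∑ t ∈ (Finset.Icc 1 x).filter (fun t : ℕ => t ≡ a [MOD q] ∧ 0 < f.eval (t : ℤ)),
      (ArithmeticFunction.moebius ((f.eval (t : ℤ)).toNat) : ℝ) := by
  symm
  rw [← Finset.sum_filter_add_sum_filter_not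
    ((Finset.Icc 1 x).filter (fun t : ℕ => t ≡ a [MOD q] ∧ 0 < f.eval (t : ℤ)))
    (fun t : ℕ => Squarefree (f.eval (t : ℤ)).toNat)]
  have hzero : ∑ t ∈ ((Finset.Icc 1 x).filter (fun t : ℕ => t ≡ a [MOD q] ∧ 0 < f.eval (t : ℤ))).filter
      (fun t : ℕ => ¬ Squarefree (f.eval (t : ℤ)).toNat),
      (ArithmeticFunction.moebius ((f.eval (t : ℤ)).toNat) : ℝ) = 0 := by
    refine Finset.sum_eq_zero fun t ht => ?_
    rw [Finset.mem_filter] at ht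
    rw [ArithmeticFunction.moebius_eq_zero_of_not_squarefree ht.2, Int.cast_zero]
  rw [hzero, add_zero, Finset.filter_filter]
  refine Finset.sum_congr ?_ fun _ _ => rfl
  ext t
  simp only [Finset.mem_filter, and_assoc]

/-- **Costume theorem for r4.** Modulo the printed theorem, `SelmerParityAtom` (stmt-Parity-9647)
is the Möbius atom of one irreducible polynomial in arithmetic progressions (PolyMobiusAtom of
route PolynomialMobius, stmt-Parity-0871, along classes `t ≡ a (q)`), here with r4's own filter
(the `Squarefree` conjunct; harmless, next theorem). -/
theorem selmerParityAtom_iff_mobiusAtomAP (hP : PencilSelmerParity) :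
    SelmerParityAtom ↔
      ∀ f : Polynomial ℤ, Irreducible f → 1 ≤ f.natDegree → 0 < f.leadingCoeff → ∀ q a : ℕ, 0 < q →
        (fun x : ℕ => ∑ t ∈ (Finset.Icc 1 x).filter (fun t : ℕ => t ≡ a [MOD q] ∧
            0 < f.eval (t : ℤ) ∧ Squarefree (f.eval (t : ℤ)).toNat),
          (ArithmeticFunction.moebius ((f.eval (t : ℤ)).toNat) : ℝ)) =o[atTop] fun x : ℕ => (x : ℝ) := by
  unfold SelmerParityAtom
  refine forall_congr' fun f => forall_congr' fun _ => forall_congr' fun _ => forall_congr' fun _ =>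
    forall_congr' fun q => forall_congr' fun a => forall_congr' fun _ => ?_
  have hfun : (fun x : ℕ => ∑ t ∈ (Finset.Icc 1 x).filter (fun t : ℕ => t ≡ a [MOD q] ∧
        0 < f.eval (t : ℤ) ∧ Squarefree (f.eval (t : ℤ)).toNat),
      (((∏ p ∈ (1728 * (f.eval (t : ℤ)).toNat + 1).primeFactors,
          (if padicValNat p (1728 * (f.eval (t : ℤ)).toNat + 1) % 6 = 2 ∨
              padicValNat p (1728 * (f.eval (t : ℤ)).toNat + 1) % 6 = 4
            then jacobiSym (-3) p else 1)) *
        (-1 : ℤ) ^ (WeierstrassCurve.selmerCorank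
          (⟨1, 0, 0, -36 * (((f.eval (t : ℤ)).toNat : ℕ) : ℚ),
            -(((f.eval (t : ℤ)).toNat : ℕ) : ℚ)⟩ : WeierstrassCurve ℚ) 2) : ℤ) : ℝ)) =
      fun x : ℕ => -∑ t ∈ (Finset.Icc 1 x).filter (fun t : ℕ => t ≡ a [MOD q] ∧
          0 < f.eval (t : ℤ) ∧ Squarefree (f.eval (t : ℤ)).toNat),
        (ArithmeticFunction.moebius ((f.eval (t : ℤ)).toNat) : ℝ) :=
    funext fun x => atom_sum_eq hP f q a x
  rw [hfun, Asymptotics.isLittleO_neg_left]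

/-- Net form: under the dictionary, r4 ⟺ "`Σ_{t ≤ x, t ≡ a (q), f(t) > 0} μ(f(t)) = o(x)` for every
irreducible `f` (positive leading coefficient) and every progression" — polynomial Chowla (Möbius
form) in APs, open for every nonlinear `f` (Teravainen2024 Conj. 1.2). -/
theorem selmerParityAtom_iff_mobiusAtomAP' (hP : PencilSelmerParity) :
    SelmerParityAtom ↔
      ∀ f : Polynomial ℤ, Irreducible f → 1 ≤ f.natDegree → 0 < f.leadingCoeff → ∀ q a : ℕ, 0 < q →
        (fun x : ℕ => ∑ t ∈ (Finset.Icc 1 x).filter (fun t : ℕ => t ≡ a [MOD q] ∧ 0 < f.eval (t : ℤ)),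
          (ArithmeticFunction.moebius ((f.eval (t : ℤ)).toNat) : ℝ)) =o[atTop] fun x : ℕ => (x : ℝ) := by
  rw [selmerParityAtom_iff_mobiusAtomAP hP]
  refine forall_congr' fun f => forall_congr' fun _ => forall_congr' fun _ => forall_congr' fun _ =>
    forall_congr' fun q => forall_congr' fun a => forall_congr' fun _ => ?_
  have hfun : (fun x : ℕ => ∑ t ∈ (Finset.Icc 1 x).filter (fun t : ℕ => t ≡ a [MOD q] ∧
        0 < f.eval (t : ℤ) ∧ Squarefree (f.eval (t : ℤ)).toNat),
      (ArithmeticFunction.moebius ((f.eval (t : ℤ)).toNat) : ℝ)) =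
      fun x : ℕ => ∑ t ∈ (Finset.Icc 1 x).filter (fun t : ℕ => t ≡ a [MOD q] ∧ 0 < f.eval (t : ℤ)),
        (ArithmeticFunction.moebius ((f.eval (t : ℤ)).toNat) : ℝ) :=
    funext fun x => mobius_sum_squarefree_filter f q a x
  rw [hfun]

end Summit.Parity.BatemanHorn.Cruxes.PencilSelmerParity.StrategyCensus


/-! ## Decomposition of the crux itself (typed, assembly proved; NOT filed — see STRATEGY-CENSUS.md §Decomposition)

The only honest split of `PencilSelmerParity` is the one the route's two-layer plan foresees
(rev 0 had it as two items `TwoParityPencil ∧ PencilRootNumber`, merged in rev 1 to keep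
`RootNumber.lean` out of the route's import cone): 2-parity on the pencil ∘ product formula on the
pencil ∘ the local root-number computation. Pieces 1–2 are PRINTED THEOREMS restricted to the
pencil (Dokchitser–Dokchitser 2010 Thm 1.4 = tree fact `WeierstrassCurve.p_parity`;
Deligne–Rohrlich = tree fact `WeierstrassCurve.rootNumber_eq_algebraicRootNumber`), unprovable in
Lean short of modularity-grade formalisation; piece 3 is provable now (Tate's algorithm on the
pencil = the route's support `PencilReduction`, then the case list of `localRootNumber`).
-/

namespace Summit.Parity.BatemanHorn.Cruxes.PencilSelmerParity.StrategyCensus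

open scoped BigOperators Classical
open Summit.Parity.BatemanHorn.Theses.SelmerPencil

/-- Piece 1 (rev 0's `TwoParityPencil`): the 2-parity theorem ON THE PENCIL —
`(-1)^{corank Sel_2∞(E_N/ℚ)} = w(E_N/ℚ)` (analytic root number). Printed theorem
(DokchitserDokchitserAnnals2010 Thm 1.4; p = 2: Monsky1996); in Lean = `WeierstrassCurve.p_parity`
restricted to `E_N`, no `_holds`. -/
theorem pencilSelmerParity_of_pieces :
    (∀ N : ℕ, 1 ≤ N → (-1 : ℤ) ^ (WeierstrassCurve.selmerCorank
        (⟨1, 0, 0, -36 * (N : ℚ), -(N : ℚ)⟩ : WeierstrassCurve ℚ) 2) =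
        (⟨1, 0, 0, -36 * (N : ℚ), -(N : ℚ)⟩ : WeierstrassCurve ℚ).rootNumber) →
    -- Piece 2: the product formula ON THE PENCIL, `w(E_N) = −∏_p w_p(E_N)` (Deligne–Rohrlich;
    -- tree fact `rootNumber_eq_algebraicRootNumber`, applicable: E_N is semistable at 2 and 3).
    (∀ N : ℕ, 1 ≤ N → (⟨1, 0, 0, -36 * (N : ℚ), -(N : ℚ)⟩ : WeierstrassCurve ℚ).rootNumber =
        (⟨1, 0, 0, -36 * (N : ℚ), -(N : ℚ)⟩ : WeierstrassCurve ℚ).algebraicRootNumber) →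
    -- Piece 3 (rev 0's `PencilRootNumber`): the local computation, provable now from
    -- `PencilReduction` + the case list of `localRootNumber` (Rohrlich 1993 Prop. 2).
    (∀ N : ℕ, 1 ≤ N → (⟨1, 0, 0, -36 * (N : ℚ), -(N : ℚ)⟩ : WeierstrassCurve ℚ).algebraicRootNumber =
        -((-1 : ℤ) ^ ArithmeticFunction.cardDistinctFactors N *
          ∏ p ∈ (1728 * N + 1).primeFactors,
            (if padicValNat p (1728 * N + 1) % 6 = 2 ∨ padicValNat p (1728 * N + 1) % 6 = 4
              then jacobiSym (-3) p else 1))) →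
    PencilSelmerParity := by
  intro h1 h2 h3 N hN
  rw [h1 N hN, h2 N hN, h3 N hN]

end Summit.Parity.BatemanHorn.Cruxes.PencilSelmerParity.StrategyCensus
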